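import Literature.Analysis.Fourier.HalfPeriodParseval

/-!
# The even and odd frequency systems on the half period `[0,1]` (and the odd system on `(−½,½]`)

Topic `Literature/Analysis/Fourier`; companion of `HalfPeriodParseval.lean` (same namespace, same coefficient
`û(ξ) = hpCoeff u ξ = ∫₀¹ u(x)e^{-iπξx}dx`). The tight frame `{e^{iπξx}}_{ξ∈ℤ}` of `L²(0,1)` (frame constant `2`:
`Σ_ξ û(ξ)·conj v̂(ξ) = 2∫₀¹ u·conj v`, `hasSum_hpCoeff_mul_conj_of_memLp`) splits into two orthonormal BASES of
`L²(0,1)` — the EVEN frequencies `{e^{2πikx}}_{k∈ℤ}` (periodic extension; Thm 5.5 on the circle of length `1`) and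
the ODD frequencies `{e^{iπ(2k+1)x}}_{k∈ℤ}` (anti-periodic extension) — each carrying exactly half of the frame
identity:

* `hasSum_hpCoeff_even_mul_conj_of_memLp` : `Σ_k û(2k)·conj v̂(2k) = ∫₀¹ u·conj v`,
* `hasSum_hpCoeff_odd_mul_conj_of_memLp`  : `Σ_k û(2k+1)·conj v̂(2k+1) = ∫₀¹ u·conj v`,

with squared / `tsum` / `Summable` forms, `MemLp u 2 (volume.restrict (Ioc 0 1))` or `ContinuousOn u (Icc 0 1)`
hypotheses, and the odd system on the CENTRED interval `(−½,½]` with basis `e^{i(2k+1)πs}`: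
`hasSum_integral_odd_centered_mul_conj_of_memLp` :
`Σ_k (∫_{−½}^{½} f e^{−iπ(2k+1)s})·conj(∫_{−½}^{½} g e^{−iπ(2k+1)s}) = ∫_{−½}^{½} f·conj g` (translation `x = s + ½`;
the unimodular constants `e^{±i(2k+1)π/2}` cancel). Also recorded first: the polarised Parseval identity on an
arbitrary cell `(a, b]` in the hypothesis shape of Mathlib's `hasSum_sq_fourierCoeffOn`
(`hasSum_conj_fourierCoeffOn_mul_of_lt`, `hasSum_fourierCoeffOn_mul_conj_of_lt`; e.g. the symmetric cell `(−1, 1]`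
of the period-`2` circle). Method: EVEN = Mathlib's Parseval on `AddCircle 1` through
`fourierCoeffOn (0 < 1) u k = û(2k)` and the period-cell lemma `hasSum_conj_fourierCoeffOn_mul`; ODD = ALL − EVEN,
re-indexed over `ℤ = 2ℤ ⊔ (2ℤ+1)` (`Function.Injective.hasSum_iff` on indicators).

Why formalised (cell landau-siegel, §E row E-102): the odd-frequency Parseval on an interval of half a period is
the device behind the positivity of the leading divided-difference kernel `Re m₀(a;x,y)` (desk notes
HOME/ls-B-ref-1/LB1-PROOF.md §10, ls-Bdet-num-2 01:55:15Z: operator `H_a` diagonal on `e^{i(2k+1)πs}`), and the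
even/odd split is the standard companion of the half-period frame. Source: Y. Katznelson, *An Introduction to
Harmonic Analysis* (3rd ed., 2004), Ch. I §5, Lemma 5.4 (Parseval, polarised) and Theorem 5.5 (completeness of
the exponentials; here on the circles of length `1` and `2`) [Katznelson2004]; plumbing private. NOT here:
derivative rules, pointwise convergence.
-/

noncomputable section

open MeasureTheory Set intervalIntegral Complex AddCircle
open scoped Real ComplexConjugate

namespace Literature.Analysis.Fourier

variable {u v : ℝ → ℂ}

/-- A function continuous on `[0,1]` is in `L²(0,1]`. [folklore] -/
private theorem memLp_two_Ioc_of_continuousOn (hu : ContinuousOn u (Icc 0 1)) :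
    MemLp u 2 (volume.restrict (Ioc (0:ℝ) 1)) := by
  have hmeas : AEStronglyMeasurable u (volume.restrict (Ioc (0:ℝ) 1)) :=
    (hu.mono Ioc_subset_Icc_self).aestronglyMeasurable measurableSet_Ioc
  rw [memLp_two_iff_integrable_sq_norm hmeas]
  have hc : ContinuousOn (fun y => ‖u y‖ ^ 2) (Icc 0 1) := (hu.norm).pow 2
  exact hc.integrableOn_Icc.mono_set Ioc_subset_Icc_self


/-! ### Polarised Parseval on an arbitrary cell `(a, b]` (the shape of Mathlib's `hasSum_sq_fourierCoeffOn`) -/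

/-- Moving the right end point of `fourierCoeffOn` along an equality (the coefficient depends on `b` through the
proof of `a < b`). [folklore] -/
private theorem fourierCoeffOn_endpoint {a b b' : ℝ} (hab : a < b) (hab' : a < b') (h : b = b') (f : ℝ → ℂ)
    (n : ℤ) : fourierCoeffOn hab f n = fourierCoeffOn hab' f n := by
  subst h
  rfl

/-- **Polarised Parseval identity on a cell `(a, b]`:** for `f, g ∈ L²(a, b]`,
`Σ_{i∈ℤ} conj (ĉ_i f) · ĉ_i g = (b − a)⁻¹ ∫_a^b conj f · g` (unconditional `HasSum`), `ĉ_i = fourierCoeffOn (a < b)`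
— Lemma 5.4 for the Fourier basis of the circle of length `b − a` (Thm 5.5); the hypothesis shape of Mathlib's
`hasSum_sq_fourierCoeffOn`, which is the case `f = g`. [cite: Katznelson2004, Ch. I §5, Lemma 5.4 (Parseval) and Thm 5.5] -/
theorem hasSum_conj_fourierCoeffOn_mul_of_lt {a b : ℝ} {f g : ℝ → ℂ} (hab : a < b)
    (hf : MemLp f 2 (volume.restrict (Ioc a b))) (hg : MemLp g 2 (volume.restrict (Ioc a b))) :
    HasSum (fun i : ℤ => conj (fourierCoeffOn hab f i) * fourierCoeffOn hab g i)
      ((b - a)⁻¹ • ∫ x in a..b, conj (f x) * g x) := by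
  have hT : 0 < b - a := by linarith
  rw [← add_sub_cancel a b] at hf hg
  have h := hasSum_conj_fourierCoeffOn_mul hT hf hg
  simp_rw [fourierCoeffOn_endpoint (lt_add_of_pos_right a hT) hab (add_sub_cancel a b)] at h
  rw [add_sub_cancel] at h
  exact h

/-- **Polarised Parseval on `(a, b]`, conjugate on the second factor:**
`Σ_{i∈ℤ} ĉ_i f · conj (ĉ_i g) = (b − a)⁻¹ ∫_a^b f · conj g`. [cite: Katznelson2004, Ch. I §5, Lemma 5.4 (Parseval) and Thm 5.5] -/
theorem hasSum_fourierCoeffOn_mul_conj_of_lt {a b : ℝ} {f g : ℝ → ℂ} (hab : a < b)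
    (hf : MemLp f 2 (volume.restrict (Ioc a b))) (hg : MemLp g 2 (volume.restrict (Ioc a b))) :
    HasSum (fun i : ℤ => fourierCoeffOn hab f i * conj (fourierCoeffOn hab g i))
      ((b - a)⁻¹ • ∫ x in a..b, f x * conj (g x)) := by
  have h := hasSum_conj_fourierCoeffOn_mul_of_lt hab hg hf
  simp_rw [mul_comm (conj (fourierCoeffOn hab g _)) _] at h
  rw [show (∫ x in a..b, f x * conj (g x)) = ∫ x in a..b, conj (g x) * f x from
    intervalIntegral.integral_congr fun x _ => by ring]
  exact h

/-! ### Even frequencies = Parseval on the circle of length `1` -/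

/-- Mathlib's period-`1` Fourier coefficient on `(0,1]` is the half-period coefficient at the EVEN frequency `2k`:
`fourierCoeffOn (0 < 1) u k = ∫₀¹ u(x)e^{−2πikx}dx = û(2k)` (the system of Thm 5.5 on the circle of length `1`).
Stated with the right end point as a hypothesis `b = 1`, so that it also rewrites coefficients whose end point is
displayed as `0 + 1` (the shape produced by the period-cell lemmas with `c = 0`, `T = 1`).
[cite: Katznelson2004, Ch. I §5.5] -/
theorem fourierCoeffOn_one_eq_hpCoeff_even {b : ℝ} (hb : b = 1) (hab : (0:ℝ) < b) (u : ℝ → ℂ) (k : ℤ) :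
    fourierCoeffOn hab u k = hpCoeff u (2 * k) := by
  subst hb
  rw [fourierCoeffOn_eq_integral, hpCoeff]
  have hker : ∀ x : ℝ, (fourier (-k) (x : AddCircle ((1:ℝ) - 0)) : ℂ) = hpKer (2 * k) x := fun x => by
    rw [fourier_coe_apply, hpKer]
    congr 1
    push_cast
    ring
  simp_rw [smul_eq_mul, hker]
  rw [show ((1:ℝ) / (1 - 0)) = 1 by norm_num, one_smul]
  exact intervalIntegral.integral_congr fun x _ => mul_comm _ _

/-- `fourierCoeffOn (0 < 1) u k = û(2k)`, plain form. [cite: Katznelson2004, Ch. I §5.5] -/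
theorem fourierCoeffOn_zero_lt_one_eq_hpCoeff (u : ℝ → ℂ) (k : ℤ) :
    fourierCoeffOn zero_lt_one u k = hpCoeff u (2 * k) :=
  fourierCoeffOn_one_eq_hpCoeff_even rfl zero_lt_one u k

/-- **Parseval for the EVEN frequencies, polarised** (conjugate on the first factor): for `u, v ∈ L²(0,1]`,
`Σ_k conj û(2k) · v̂(2k) = ∫₀¹ conj u · v` — Lemma 5.4 for the complete orthonormal system `{e^{2πikx}}` of
`L²(ℝ/ℤ)` (Thm 5.5, period `1`). [cite: Katznelson2004, Ch. I §5, Lemma 5.4 (Parseval) and Thm 5.5] -/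
theorem hasSum_conj_hpCoeff_even_mul_of_memLp (hu : MemLp u 2 (volume.restrict (Ioc 0 1)))
    (hv : MemLp v 2 (volume.restrict (Ioc 0 1))) :
    HasSum (fun k : ℤ => conj (hpCoeff u (2 * k)) * hpCoeff v (2 * k))
      (∫ x in (0:ℝ)..1, conj (u x) * v x) := by
  have hu' : MemLp u 2 (volume.restrict (Ioc (0:ℝ) (0 + 1))) := by rwa [zero_add]
  have hv' : MemLp v 2 (volume.restrict (Ioc (0:ℝ) (0 + 1))) := by rwa [zero_add]
  have h := hasSum_conj_fourierCoeffOn_mul one_pos hu' hv'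
  simp_rw [fourierCoeffOn_one_eq_hpCoeff_even (zero_add 1)] at h
  simp only [zero_add, inv_one, one_smul] at h
  exact h

/-- **Parseval for the EVEN frequencies, polarised:** `Σ_k û(2k)·conj v̂(2k) = ∫₀¹ u·conj v` for `u, v ∈ L²(0,1]`.
[cite: Katznelson2004, Ch. I §5, Lemma 5.4 (Parseval) and Thm 5.5] -/
theorem hasSum_hpCoeff_even_mul_conj_of_memLp (hu : MemLp u 2 (volume.restrict (Ioc 0 1)))
    (hv : MemLp v 2 (volume.restrict (Ioc 0 1))) :
    HasSum (fun k : ℤ => hpCoeff u (2 * k) * conj (hpCoeff v (2 * k)))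
      (∫ x in (0:ℝ)..1, u x * conj (v x)) := by
  have h := hasSum_conj_hpCoeff_even_mul_of_memLp hv hu
  simp_rw [mul_comm (conj (hpCoeff v _)) _] at h
  rw [show (∫ x in (0:ℝ)..1, u x * conj (v x)) = ∫ x in (0:ℝ)..1, conj (v x) * u x from
    intervalIntegral.integral_congr fun x _ => by ring]
  exact h

/-- **Parseval for the EVEN frequencies, squared form:** `Σ_k ‖û(2k)‖² = ∫₀¹ ‖u‖²` for `u ∈ L²(0,1]` (Thm 5.5 (a)
on the circle of length `1`). [cite: Katznelson2004, Ch. I §5, Lemma 5.4 (Parseval) and Thm 5.5] -/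
theorem hasSum_sq_hpCoeff_even_of_memLp (hu : MemLp u 2 (volume.restrict (Ioc 0 1))) :
    HasSum (fun k : ℤ => ‖hpCoeff u (2 * k)‖ ^ 2) (∫ x in (0:ℝ)..1, ‖u x‖ ^ 2) := by
  have h := hasSum_conj_hpCoeff_even_mul_of_memLp hu hu
  simp_rw [Complex.conj_mul'] at h
  have e1 : (fun k : ℤ => ((‖hpCoeff u (2 * k)‖ : ℂ)) ^ 2) =
      fun k : ℤ => (((‖hpCoeff u (2 * k)‖ ^ 2 : ℝ)) : ℂ) := by
    funext k
    push_cast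
    rfl
  have e2 : (∫ x in (0:ℝ)..1, ((‖u x‖ : ℂ)) ^ 2) = (((∫ x in (0:ℝ)..1, ‖u x‖ ^ 2 : ℝ)) : ℂ) := by
    rw [← intervalIntegral.integral_ofReal]
    push_cast
    rfl
  rw [e1, e2] at h
  exact Complex.hasSum_ofReal.mp h

/-! ### Odd frequencies = ALL − EVEN -/

/-- The even integers are the range of `k ↦ 2k`. [folklore] -/
private theorem mem_range_two_mul_iff (ξ : ℤ) : ξ ∈ Set.range (fun k : ℤ => 2 * k) ↔ Even ξ := by
  constructor
  · rintro ⟨k, rfl⟩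
    exact ⟨k, two_mul k⟩
  · rintro ⟨r, hr⟩
    exact ⟨r, by rw [hr]; exact two_mul r⟩

/-- The odd integers are the range of `k ↦ 2k + 1`. [folklore] -/
private theorem mem_range_two_mul_add_one_iff (ξ : ℤ) :
    ξ ∈ Set.range (fun k : ℤ => 2 * k + 1) ↔ ¬ Even ξ := by
  rw [Int.not_even_iff_odd]
  constructor
  · rintro ⟨k, rfl⟩
    exact ⟨k, rfl⟩
  · rintro ⟨m, hm⟩
    exact ⟨m, hm.symm⟩

/-- Splitting a sum over `ℤ` into its even and odd halves: if `Σ_ξ f ξ = t` and `Σ_k f(2k) = e` then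
`Σ_k f(2k+1) = t − e`. [folklore] -/
private theorem hasSum_odd_of_hasSum_of_hasSum_even {f : ℤ → ℂ} {t e : ℂ} (ht : HasSum f t)
    (he : HasSum (fun k : ℤ => f (2 * k)) e) : HasSum (fun k : ℤ => f (2 * k + 1)) (t - e) := by
  set E : Set ℤ := {ξ | Even ξ} with hE
  have hinj2 : Function.Injective (fun k : ℤ => 2 * k) := mul_right_injective₀ two_ne_zero
  have hinj21 : Function.Injective (fun k : ℤ => 2 * k + 1) :=
    (add_left_injective (1:ℤ)).comp (mul_right_injective₀ two_ne_zero)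
  -- the even half as an indicator sum over `ℤ`
  have hE_ind : HasSum (E.indicator f) e := by
    have hvan : ∀ ξ ∉ Set.range (fun k : ℤ => 2 * k), E.indicator f ξ = 0 := fun ξ hξ => by
      rw [mem_range_two_mul_iff] at hξ
      exact Set.indicator_of_notMem (show ξ ∉ E from hξ) f
    have hcomp : (E.indicator f) ∘ (fun k : ℤ => 2 * k) = fun k : ℤ => f (2 * k) := by
      funext k
      exact Set.indicator_of_mem (show 2 * k ∈ E from ⟨k, two_mul k⟩) f
    have he' : HasSum ((E.indicator f) ∘ (fun k : ℤ => 2 * k)) e := by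
      rw [hcomp]
      exact he
    exact (hinj2.hasSum_iff hvan).mp he'
  -- the odd half as the complementary indicator
  have hO_ind : HasSum (Eᶜ.indicator f) (t - e) := by
    have hsplit : Eᶜ.indicator f = fun ξ => f ξ - E.indicator f ξ := by
      funext ξ
      have := congrArg (fun g => g ξ) (Set.indicator_self_add_compl E f)
      simp only [Pi.add_apply] at this
      linear_combination this
    rw [hsplit]
    exact ht.sub hE_ind
  have hvan' : ∀ ξ ∉ Set.range (fun k : ℤ => 2 * k + 1), Eᶜ.indicator f ξ = 0 := fun ξ hξ => by
    rw [mem_range_two_mul_add_one_iff, not_not] at hξ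
    exact Set.indicator_of_notMem (show ξ ∉ Eᶜ from fun h => h hξ) f
  have hcomp' : (Eᶜ.indicator f) ∘ (fun k : ℤ => 2 * k + 1) = fun k : ℤ => f (2 * k + 1) := by
    funext k
    refine Set.indicator_of_mem (show 2 * k + 1 ∈ Eᶜ from fun h => ?_) f
    exact Int.not_even_iff_odd.mpr ⟨k, rfl⟩ h
  have h := (hinj21.hasSum_iff hvan').mpr hO_ind
  rw [hcomp'] at h
  exact h

/-- **Parseval for the ODD frequencies, polarised** (conjugate on the first factor): for `u, v ∈ L²(0,1]`,
`Σ_k conj û(2k+1) · v̂(2k+1) = ∫₀¹ conj u · v` — the anti-periodic system `{e^{iπ(2k+1)x}}_k` is a complete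
orthonormal system of `L²(0,1)` (Lemma 5.4; here: the full frame `= 2∫` of `HalfPeriodParseval` minus the even half).
[cite: Katznelson2004, Ch. I §5, Lemma 5.4 (Parseval) and Thm 5.5] -/
theorem hasSum_conj_hpCoeff_odd_mul_of_memLp (hu : MemLp u 2 (volume.restrict (Ioc 0 1)))
    (hv : MemLp v 2 (volume.restrict (Ioc 0 1))) :
    HasSum (fun k : ℤ => conj (hpCoeff u (2 * k + 1)) * hpCoeff v (2 * k + 1))
      (∫ x in (0:ℝ)..1, conj (u x) * v x) := by
  have h := hasSum_odd_of_hasSum_of_hasSum_even (f := fun ξ : ℤ => conj (hpCoeff u ξ) * hpCoeff v ξ)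
    (hasSum_conj_hpCoeff_mul_of_memLp hu hv) (hasSum_conj_hpCoeff_even_mul_of_memLp hu hv)
  have e : (2 * ∫ x in (0:ℝ)..1, conj (u x) * v x) - (∫ x in (0:ℝ)..1, conj (u x) * v x) =
      ∫ x in (0:ℝ)..1, conj (u x) * v x := by ring
  rw [e] at h
  exact h

/-- **Parseval for the ODD frequencies, polarised:** `Σ_k û(2k+1)·conj v̂(2k+1) = ∫₀¹ u·conj v` for
`u, v ∈ L²(0,1]`. [cite: Katznelson2004, Ch. I §5, Lemma 5.4 (Parseval) and Thm 5.5] -/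
theorem hasSum_hpCoeff_odd_mul_conj_of_memLp (hu : MemLp u 2 (volume.restrict (Ioc 0 1)))
    (hv : MemLp v 2 (volume.restrict (Ioc 0 1))) :
    HasSum (fun k : ℤ => hpCoeff u (2 * k + 1) * conj (hpCoeff v (2 * k + 1)))
      (∫ x in (0:ℝ)..1, u x * conj (v x)) := by
  have h := hasSum_conj_hpCoeff_odd_mul_of_memLp hv hu
  simp_rw [mul_comm (conj (hpCoeff v _)) _] at h
  rw [show (∫ x in (0:ℝ)..1, u x * conj (v x)) = ∫ x in (0:ℝ)..1, conj (v x) * u x from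
    intervalIntegral.integral_congr fun x _ => by ring]
  exact h

/-- **Parseval for the ODD frequencies, squared form:** `Σ_k ‖û(2k+1)‖² = ∫₀¹ ‖u‖²` for `u ∈ L²(0,1]`.
[cite: Katznelson2004, Ch. I §5, Lemma 5.4 (Parseval) and Thm 5.5] -/
theorem hasSum_sq_hpCoeff_odd_of_memLp (hu : MemLp u 2 (volume.restrict (Ioc 0 1))) :
    HasSum (fun k : ℤ => ‖hpCoeff u (2 * k + 1)‖ ^ 2) (∫ x in (0:ℝ)..1, ‖u x‖ ^ 2) := by
  have h := hasSum_conj_hpCoeff_odd_mul_of_memLp hu hu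
  simp_rw [Complex.conj_mul'] at h
  have e1 : (fun k : ℤ => ((‖hpCoeff u (2 * k + 1)‖ : ℂ)) ^ 2) =
      fun k : ℤ => (((‖hpCoeff u (2 * k + 1)‖ ^ 2 : ℝ)) : ℂ) := by
    funext k
    push_cast
    rfl
  have e2 : (∫ x in (0:ℝ)..1, ((‖u x‖ : ℂ)) ^ 2) = (((∫ x in (0:ℝ)..1, ‖u x‖ ^ 2 : ℝ)) : ℂ) := by
    rw [← intervalIntegral.integral_ofReal]
    push_cast
    rfl
  rw [e1, e2] at h
  exact Complex.hasSum_ofReal.mp h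

/-- `∑' k, û(2k+1) conj v̂(2k+1) = ∫₀¹ u v̄` for `u, v ∈ L²(0,1]`.
[cite: Katznelson2004, Ch. I §5, Lemma 5.4 (Parseval) and Thm 5.5] -/
theorem tsum_hpCoeff_odd_mul_conj_of_memLp (hu : MemLp u 2 (volume.restrict (Ioc 0 1)))
    (hv : MemLp v 2 (volume.restrict (Ioc 0 1))) :
    ∑' k : ℤ, hpCoeff u (2 * k + 1) * conj (hpCoeff v (2 * k + 1)) = ∫ x in (0:ℝ)..1, u x * conj (v x) :=
  (hasSum_hpCoeff_odd_mul_conj_of_memLp hu hv).tsum_eq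

/-- `∑' k, ‖û(2k+1)‖² = ∫₀¹ ‖u‖²` for `u ∈ L²(0,1]`. [cite: Katznelson2004, Ch. I §5, Lemma 5.4 (Parseval) and Thm 5.5] -/
theorem tsum_sq_hpCoeff_odd_of_memLp (hu : MemLp u 2 (volume.restrict (Ioc 0 1))) :
    ∑' k : ℤ, ‖hpCoeff u (2 * k + 1)‖ ^ 2 = ∫ x in (0:ℝ)..1, ‖u x‖ ^ 2 :=
  (hasSum_sq_hpCoeff_odd_of_memLp hu).tsum_eq

/-- Square summability of the odd-frequency coefficients of `u ∈ L²(0,1]`.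
[cite: Katznelson2004, Ch. I §5, Lemma 5.4 (Parseval) and Thm 5.5] -/
theorem summable_sq_hpCoeff_odd_of_memLp (hu : MemLp u 2 (volume.restrict (Ioc 0 1))) :
    Summable (fun k : ℤ => ‖hpCoeff u (2 * k + 1)‖ ^ 2) :=
  (hasSum_sq_hpCoeff_odd_of_memLp hu).summable

/-- `∑' k, ‖û(2k)‖² = ∫₀¹ ‖u‖²` for `u ∈ L²(0,1]`. [cite: Katznelson2004, Ch. I §5, Lemma 5.4 (Parseval) and Thm 5.5] -/
theorem tsum_sq_hpCoeff_even_of_memLp (hu : MemLp u 2 (volume.restrict (Ioc 0 1))) :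
    ∑' k : ℤ, ‖hpCoeff u (2 * k)‖ ^ 2 = ∫ x in (0:ℝ)..1, ‖u x‖ ^ 2 :=
  (hasSum_sq_hpCoeff_even_of_memLp hu).tsum_eq

/-! ### Continuous data -/

/-- Odd-frequency Parseval, polarised, for data continuous on `[0,1]`.
[cite: Katznelson2004, Ch. I §5, Lemma 5.4 (Parseval) and Thm 5.5] -/
theorem hasSum_hpCoeff_odd_mul_conj_of_continuousOn (hu : ContinuousOn u (Icc 0 1))
    (hv : ContinuousOn v (Icc 0 1)) :
    HasSum (fun k : ℤ => hpCoeff u (2 * k + 1) * conj (hpCoeff v (2 * k + 1)))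
      (∫ x in (0:ℝ)..1, u x * conj (v x)) :=
  hasSum_hpCoeff_odd_mul_conj_of_memLp (memLp_two_Ioc_of_continuousOn hu)
    (memLp_two_Ioc_of_continuousOn hv)

/-- Odd-frequency Parseval, squared form, for data continuous on `[0,1]`.
[cite: Katznelson2004, Ch. I §5, Lemma 5.4 (Parseval) and Thm 5.5] -/
theorem hasSum_sq_hpCoeff_odd_of_continuousOn (hu : ContinuousOn u (Icc 0 1)) :
    HasSum (fun k : ℤ => ‖hpCoeff u (2 * k + 1)‖ ^ 2) (∫ x in (0:ℝ)..1, ‖u x‖ ^ 2) :=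
  hasSum_sq_hpCoeff_odd_of_memLp (memLp_two_Ioc_of_continuousOn hu)

/-- Even-frequency Parseval, polarised, for data continuous on `[0,1]`.
[cite: Katznelson2004, Ch. I §5, Lemma 5.4 (Parseval) and Thm 5.5] -/
theorem hasSum_hpCoeff_even_mul_conj_of_continuousOn (hu : ContinuousOn u (Icc 0 1))
    (hv : ContinuousOn v (Icc 0 1)) :
    HasSum (fun k : ℤ => hpCoeff u (2 * k) * conj (hpCoeff v (2 * k)))
      (∫ x in (0:ℝ)..1, u x * conj (v x)) :=
  hasSum_hpCoeff_even_mul_conj_of_memLp (memLp_two_Ioc_of_continuousOn hu)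
    (memLp_two_Ioc_of_continuousOn hv)

/-! ### The odd system on the centred interval `(−½, ½]` (basis `e^{i(2k+1)πs}`) -/

section Centered

variable {f g : ℝ → ℂ}

/-- Translation `x ↦ x − ½` carries `L²(−½,½]` data to `L²(0,1]` data. [folklore] -/
private theorem memLp_comp_sub_half (hf : MemLp f 2 (volume.restrict (Ioc (-(1/2:ℝ)) (1/2)))) :
    MemLp (fun x => f (x - 1/2)) 2 (volume.restrict (Ioc (0:ℝ) 1)) := by
  have hmp : MeasurePreserving (fun x : ℝ => x - 1/2) volume volume := measurePreserving_sub_right volume _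
  have h2 := hmp.restrict_preimage (measurableSet_Ioc (a := -(1/2:ℝ)) (b := 1/2))
  have hpre : (fun x : ℝ => x - 1/2) ⁻¹' Ioc (-(1/2:ℝ)) (1/2) = Ioc 0 1 := by
    ext x; simp only [Set.mem_preimage, Set.mem_Ioc]; constructor <;> intro h <;> constructor <;> linarith [h.1, h.2]
  rw [hpre] at h2
  exact hf.comp_measurePreserving h2

/-- The centred odd coefficient is a unimodular multiple of the half-period odd coefficient of the translate. [folklore] -/
private theorem integral_odd_centered_eq (f : ℝ → ℂ) (k : ℤ) :
    ∫ s in (-(1/2:ℝ))..1/2, f s * Complex.exp (-((π : ℂ) * I * (2 * k + 1) * s)) =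
      Complex.exp ((π : ℂ) * I * (2 * k + 1) / 2) * hpCoeff (fun x => f (x - 1/2)) (2 * k + 1) := by
  rw [hpCoeff, ← intervalIntegral.integral_const_mul]
  have hsub := intervalIntegral.integral_comp_sub_right
    (fun s => f s * Complex.exp (-((π : ℂ) * I * (2 * k + 1) * s))) (1/2 : ℝ) (a := 0) (b := 1)
  rw [show (0:ℝ) - 1/2 = -(1/2) by norm_num, show (1:ℝ) - 1/2 = 1/2 by norm_num] at hsub
  rw [← hsub]
  refine intervalIntegral.integral_congr fun x _ => ?_
  simp only [hpKer]
  rw [mul_left_comm, ← Complex.exp_add]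
  congr 2
  push_cast
  ring

/-- **Odd-frequency Parseval on the centred interval `(−½,½]`, polarised:** for `f, g ∈ L²(−½,½]`,
`Σ_k c_k(f)·conj c_k(g) = ∫_{−½}^{½} f·conj g`, `c_k(f) = ∫_{−½}^{½} f(s) e^{−iπ(2k+1)s} ds` — the orthonormal basis
`{e^{i(2k+1)πs}}_{k∈ℤ}` of `L²(−½,½)`. [cite: Katznelson2004, Ch. I §5, Lemma 5.4 (Parseval) and Thm 5.5] -/
theorem hasSum_integral_odd_centered_mul_conj_of_memLp
    (hf : MemLp f 2 (volume.restrict (Ioc (-(1/2:ℝ)) (1/2))))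
    (hg : MemLp g 2 (volume.restrict (Ioc (-(1/2:ℝ)) (1/2)))) :
    HasSum (fun k : ℤ => (∫ s in (-(1/2:ℝ))..1/2, f s * Complex.exp (-((π : ℂ) * I * (2 * k + 1) * s))) *
        conj (∫ s in (-(1/2:ℝ))..1/2, g s * Complex.exp (-((π : ℂ) * I * (2 * k + 1) * s))))
      (∫ s in (-(1/2:ℝ))..1/2, f s * conj (g s)) := by
  have h := hasSum_hpCoeff_odd_mul_conj_of_memLp (memLp_comp_sub_half hf) (memLp_comp_sub_half hg)
  have hval : (∫ x in (0:ℝ)..1, f (x - 1/2) * conj (g (x - 1/2))) = ∫ s in (-(1/2:ℝ))..1/2, f s * conj (g s) := by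
    have hsub := intervalIntegral.integral_comp_sub_right (fun s => f s * conj (g s)) (1/2 : ℝ) (a := 0) (b := 1)
    rw [show (0:ℝ) - 1/2 = -(1/2) by norm_num, show (1:ℝ) - 1/2 = 1/2 by norm_num] at hsub
    exact hsub
  rw [hval] at h
  have hunit : ∀ k : ℤ, Complex.exp ((π : ℂ) * I * (2 * k + 1) / 2) *
      conj (Complex.exp ((π : ℂ) * I * (2 * k + 1) / 2)) = 1 := fun k => by
    rw [← Complex.exp_conj, ← Complex.exp_add]
    simp only [map_div₀, map_mul, map_add, map_one, Complex.conj_ofReal, Complex.conj_I, map_ofNat,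
      map_intCast]
    rw [show (π : ℂ) * I * (2 * k + 1) / 2 + π * -I * (2 * k + 1) / 2 = 0 by ring, Complex.exp_zero]
  have e : (fun k : ℤ => (∫ s in (-(1/2:ℝ))..1/2, f s * Complex.exp (-((π : ℂ) * I * (2 * k + 1) * s))) *
        conj (∫ s in (-(1/2:ℝ))..1/2, g s * Complex.exp (-((π : ℂ) * I * (2 * k + 1) * s)))) =
      fun k : ℤ => hpCoeff (fun x => f (x - 1/2)) (2 * k + 1) * conj (hpCoeff (fun x => g (x - 1/2)) (2 * k + 1)) := by
    funext k
    rw [integral_odd_centered_eq, integral_odd_centered_eq, map_mul]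
    calc _ = (Complex.exp ((π : ℂ) * I * (2 * k + 1) / 2) * conj (Complex.exp ((π : ℂ) * I * (2 * k + 1) / 2))) *
          (hpCoeff (fun x => f (x - 1/2)) (2 * k + 1) * conj (hpCoeff (fun x => g (x - 1/2)) (2 * k + 1))) := by ring
      _ = _ := by rw [hunit k, one_mul]
  rw [e]
  exact h

/-- **Odd-frequency Parseval on the centred interval `(−½,½]`, squared form:**
`Σ_k ‖∫_{−½}^{½} f(s) e^{−iπ(2k+1)s} ds‖² = ∫_{−½}^{½} ‖f‖²` for `f ∈ L²(−½,½]`.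
[cite: Katznelson2004, Ch. I §5, Lemma 5.4 (Parseval) and Thm 5.5] -/
theorem hasSum_sq_integral_odd_centered_of_memLp
    (hf : MemLp f 2 (volume.restrict (Ioc (-(1/2:ℝ)) (1/2)))) :
    HasSum (fun k : ℤ => ‖∫ s in (-(1/2:ℝ))..1/2, f s * Complex.exp (-((π : ℂ) * I * (2 * k + 1) * s))‖ ^ 2)
      (∫ s in (-(1/2:ℝ))..1/2, ‖f s‖ ^ 2) := by
  have h := hasSum_integral_odd_centered_mul_conj_of_memLp hf hf
  simp_rw [Complex.mul_conj'] at h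
  have e1 : (fun k : ℤ =>
      ((‖∫ s in (-(1/2:ℝ))..1/2, f s * Complex.exp (-((π : ℂ) * I * (2 * k + 1) * s))‖ : ℂ)) ^ 2) =
      fun k : ℤ =>
      (((‖∫ s in (-(1/2:ℝ))..1/2, f s * Complex.exp (-((π : ℂ) * I * (2 * k + 1) * s))‖ ^ 2 : ℝ)) : ℂ) := by
    funext k
    push_cast
    rfl
  have e2 : (∫ s in (-(1/2:ℝ))..1/2, ((‖f s‖ : ℂ)) ^ 2) =
      (((∫ s in (-(1/2:ℝ))..1/2, ‖f s‖ ^ 2 : ℝ)) : ℂ) := by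
    rw [← intervalIntegral.integral_ofReal]
    push_cast
    rfl
  rw [e1, e2] at h
  exact Complex.hasSum_ofReal.mp h

/-- A function continuous on `[−½,½]` is in `L²(−½,½]`. [folklore] -/
private theorem memLp_two_Ioc_centered_of_continuousOn (hf : ContinuousOn f (Icc (-(1/2:ℝ)) (1/2))) :
    MemLp f 2 (volume.restrict (Ioc (-(1/2:ℝ)) (1/2))) := by
  have hmeas : AEStronglyMeasurable f (volume.restrict (Ioc (-(1/2:ℝ)) (1/2))) :=
    (hf.mono Ioc_subset_Icc_self).aestronglyMeasurable measurableSet_Ioc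
  rw [memLp_two_iff_integrable_sq_norm hmeas]
  have hc : ContinuousOn (fun y => ‖f y‖ ^ 2) (Icc (-(1/2:ℝ)) (1/2)) := (hf.norm).pow 2
  exact hc.integrableOn_Icc.mono_set Ioc_subset_Icc_self

/-- Odd-frequency Parseval on the centred interval, polarised, for data continuous on `[−½,½]`.
[cite: Katznelson2004, Ch. I §5, Lemma 5.4 (Parseval) and Thm 5.5] -/
theorem hasSum_integral_odd_centered_mul_conj_of_continuousOn
    (hf : ContinuousOn f (Icc (-(1/2:ℝ)) (1/2))) (hg : ContinuousOn g (Icc (-(1/2:ℝ)) (1/2))) :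
    HasSum (fun k : ℤ => (∫ s in (-(1/2:ℝ))..1/2, f s * Complex.exp (-((π : ℂ) * I * (2 * k + 1) * s))) *
        conj (∫ s in (-(1/2:ℝ))..1/2, g s * Complex.exp (-((π : ℂ) * I * (2 * k + 1) * s))))
      (∫ s in (-(1/2:ℝ))..1/2, f s * conj (g s)) :=
  hasSum_integral_odd_centered_mul_conj_of_memLp (memLp_two_Ioc_centered_of_continuousOn hf)
    (memLp_two_Ioc_centered_of_continuousOn hg)

/-- Odd-frequency Parseval on the centred interval, squared form, for data continuous on `[−½,½]`.
[cite: Katznelson2004, Ch. I §5, Lemma 5.4 (Parseval) and Thm 5.5] -/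
theorem hasSum_sq_integral_odd_centered_of_continuousOn (hf : ContinuousOn f (Icc (-(1/2:ℝ)) (1/2))) :
    HasSum (fun k : ℤ => ‖∫ s in (-(1/2:ℝ))..1/2, f s * Complex.exp (-((π : ℂ) * I * (2 * k + 1) * s))‖ ^ 2)
      (∫ s in (-(1/2:ℝ))..1/2, ‖f s‖ ^ 2) :=
  hasSum_sq_integral_odd_centered_of_memLp (memLp_two_Ioc_centered_of_continuousOn hf)

end Centered

end Literature.Analysis.Fourier
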